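import Summits.QuantumFields.GaugeBoot.FluctuationHafnian
import HarnessLib

/-!
# Fluctuations of Wilson loops, XVI: the slot-Leibniz identity of the hafnian (gauge-boot, ADDENDUM 33 part B)

HONEST FRAMING (cell `pub-gaugeboot`, page 1 of every file): the venture produces certified bounds
on lattice expectations at stated coupling, gauge group, dimension and torus size; NOT a mass gap,
NOT a continuum limit, NOT a string tension; NOT Yang–Mills-summit-bearing (barriers
`FixedCouplingUltralocality`, `PerturbativeInvisibility`).  Pure algebra: no gauge theory in this file.

## Content

`hafnian_slot_leibniz`: for a family of LINEAR slot functionals `D_A : (α → ℝ) → ℝ` and the hafnian `Hf` of a kernel `κ`,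
the slot operator `Σ_{j ∈ S} D_{Cs_j}(C' ↦ Hf(Cs[j ≔ C'], S))` equals the pair-source
`Σ_{a < b ∈ S} x(a, b) · Hf(Cs, S ∖ {a, b})` with `x(a, b) = D_{Cs_a}(κ(·, Cs_b)) + D_{Cs_b}(κ(Cs_a, ·))` — every slot lies
in exactly one pair of every perfect matching.  (Induction on `S`, peeling the minimum; the triple sum over a pair and a
third slot is re-ordered through indicator sums over `S`.)  Also: the general and the double erasure forms of the
hafnian (`hafnian_eraseIdx_image`, `hafnian_eraseIdx_eraseIdx`).

Everything is `[folklore]` (Wick's rule bookkeeping).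
-/

noncomputable section

open Finset

namespace Summit.QuantumFields.GaugeBoot

namespace StringDuality

variable {α : Type*}

/-- An erased sum as an indicator sum. [folklore] -/
theorem sum_erase_ite (T : Finset ℕ) (y : ℕ) (f : ℕ → ℝ) :
    ∑ x ∈ T.erase y, f x = ∑ x ∈ T, if x = y then 0 else f x := by
  classical
  rw [← Finset.filter_ne', Finset.sum_filter]
  refine Finset.sum_congr rfl fun x _ => ?_
  by_cases hx : x = y
  · rw [if_pos hx, if_neg (not_not.mpr hx)]
  · rw [if_neg hx, if_pos hx]

/-- Updated entries: the updated slot. [folklore] -/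
theorem getD_set_self' (Cs : List α) {j : ℕ} (hj : j < Cs.length) (C' dflt : α) : (Cs.set j C').getD j dflt = C' := by
  simp [List.getD_eq_getElem?_getD, hj]

/-- Updated entries: the other slots. [folklore] -/
theorem getD_set_ne' (Cs : List α) {i j : ℕ} (hij : i ≠ j) (C' dflt : α) : (Cs.set j C').getD i dflt = Cs.getD i dflt := by
  simp only [List.getD_eq_getElem?_getD, List.getElem?_set_ne hij.symm]

section erase

variable {κ : α → α → ℝ} {dflt : α} {Hf : List α → Finset ℕ → ℝ} (h0 : ∀ Cs : List α, Hf Cs ∅ = 1)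
  (hS : ∀ (Cs : List α) (S : Finset ℕ) (h : S.Nonempty), Hf Cs S =
    ∑ i ∈ S.erase (S.min' h), κ (Cs.getD (S.min' h) dflt) (Cs.getD i dflt) * Hf Cs ((S.erase (S.min' h)).erase i))
include h0 hS

/-- General erasure form: erasing position `p` relabels the positions by the map skipping `p`. [folklore] -/
theorem hafnian_eraseIdx_image (Cs : List α) (p : ℕ) (T : Finset ℕ) :
    Hf (Cs.eraseIdx p) T = Hf Cs (T.image fun i => if i < p then i else i + 1) := by
  classical
  have he : StrictMono (fun i : ℕ => if i < p then i else i + 1) := by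
    intro i j hij
    dsimp only
    split_ifs <;> omega
  refine hafnian_relabel h0 hS he T _ _ fun i _ => ?_
  simp only [List.getD_eq_getElem?_getD, List.getElem?_eraseIdx]
  split_ifs <;> rfl

/-- Double erasure of two positions `j < j' < m` of an `m`-list. [folklore] -/
theorem hafnian_eraseIdx_eraseIdx (Cs : List α) {j j' m : ℕ} (hjj : j < j') (hj'm : j' < m) :
    Hf ((Cs.eraseIdx j').eraseIdx j) (Finset.range (m - 2)) = Hf Cs (((Finset.range m).erase j').erase j) := by
  classical
  rw [hafnian_eraseIdx h0 hS _ (show j ≤ m - 2 by omega), show m - 2 + 1 = m - 1 by omega,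
    hafnian_eraseIdx_image h0 hS]
  congr 1
  ext k
  simp only [Finset.mem_image, Finset.mem_erase, Finset.mem_range]
  constructor
  · rintro ⟨i, ⟨hi1, hi2⟩, rfl⟩
    split_ifs <;> omega
  · rintro ⟨hk1, hk2, hk3⟩
    by_cases hkj : k < j'
    · exact ⟨k, ⟨by omega, by omega⟩, by simp [hkj]⟩
    · exact ⟨k - 1, ⟨by omega, by omega⟩, by split_ifs <;> omega⟩

end erase

section leibniz

variable {κ : α → α → ℝ} {dflt : α} {Hf : List α → Finset ℕ → ℝ} (h0 : ∀ Cs : List α, Hf Cs ∅ = 1)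
  (hS : ∀ (Cs : List α) (S : Finset ℕ) (h : S.Nonempty), Hf Cs S =
    ∑ i ∈ S.erase (S.min' h), κ (Cs.getD (S.min' h) dflt) (Cs.getD i dflt) * Hf Cs ((S.erase (S.min' h)).erase i))
  (D : α → (α → ℝ) → ℝ)
  (hadd : ∀ (A : α) (g g' : α → ℝ), D A (fun X => g X + g' X) = D A g + D A g')
  (hmul : ∀ (A : α) (c : ℝ) (g : α → ℝ), D A (fun X => c * g X) = c * D A g)
include h0 hS hadd hmul

omit h0 hS in
/-- Linearity over finite sums. [folklore] -/
theorem slot_sum {ι : Type*} (A : α) (s : Finset ι) (g : ι → α → ℝ) :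
    D A (fun X => ∑ i ∈ s, g i X) = ∑ i ∈ s, D A (g i) := by
  classical
  have hzero : D A (fun _ => 0) = 0 := by
    have h := hmul A 0 (fun _ => 0)
    simp only [zero_mul] at h
    exact h
  induction s using Finset.induction_on with
  | empty => simp only [Finset.sum_empty]; exact hzero
  | insert i s hi ih =>
    simp only [Finset.sum_insert hi]
    rw [hadd, ih]

/-- ★ The slot-Leibniz identity of the hafnian. [folklore] -/
theorem hafnian_slot_leibniz : ∀ (S : Finset ℕ) (Cs : List α), (∀ i ∈ S, i < Cs.length) →
    ∑ j ∈ S, D (Cs.getD j dflt) (fun C' => Hf (Cs.set j C') S) =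
      ∑ a ∈ S, ∑ b ∈ S, if a < b then
        (D (Cs.getD a dflt) (fun C' => κ C' (Cs.getD b dflt)) + D (Cs.getD b dflt) (fun C' => κ (Cs.getD a dflt) C'))
          * Hf Cs ((S.erase a).erase b) else 0 := by
  classical
  intro S
  induction S using Finset.strongInduction with
  | H S ih =>
    intro Cs hlen
    by_cases h : S.Nonempty
    swap
    · rw [Finset.not_nonempty_iff_eq_empty.mp h]; simp
    -- ### peel the minimum `a`; `T = S ∖ a`
    set a : ℕ := S.min' h with haeq
    have ha : a ∈ S := Finset.min'_mem S h
    have halen : a < Cs.length := hlen a ha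
    have hT : ∀ i ∈ S.erase a, i ≠ a ∧ i ∈ S := fun i hi => Finset.mem_erase.mp hi
    have hlt : ∀ i ∈ S.erase a, a < i := fun i hi =>
      lt_of_le_of_ne (Finset.min'_le S i (hT i hi).2) (Ne.symm (hT i hi).1)
    have hsubT : ∀ i, (S.erase a).erase i ⊂ S := fun i => lt_of_le_of_lt (Finset.erase_subset _ _) (Finset.erase_ssubset ha)
    have hmul' : ∀ (A : α) (g : α → ℝ) (c : ℝ), D A (fun X => g X * c) = D A g * c := by
      intro A g c
      have h1 : (fun X => g X * c) = fun X => c * g X := by funext X; ring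
      rw [h1, hmul, mul_comm]
    -- ### the updated hafnians, expanded at `a`
    have Ea : (fun C' => Hf (Cs.set a C') S) = fun C' => ∑ i ∈ S.erase a, Hf Cs ((S.erase a).erase i) * κ C' (Cs.getD i dflt) := by
      funext C'
      rw [hS (Cs.set a C') S h, ← haeq]
      refine Finset.sum_congr rfl fun i hi => ?_
      rw [getD_set_self' Cs halen, getD_set_ne' Cs (hT i hi).1,
        hafnian_set_of_not_mem h0 hS _ Cs (fun hm => (Finset.mem_erase.mp (Finset.mem_of_mem_erase hm)).1 rfl) C', mul_comm]
    have Ej : ∀ j ∈ S.erase a, (fun C' => Hf (Cs.set j C') S) = fun C' =>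
        Hf Cs ((S.erase a).erase j) * κ (Cs.getD a dflt) C'
          + ∑ i ∈ (S.erase a).erase j, κ (Cs.getD a dflt) (Cs.getD i dflt) * Hf (Cs.set j C') ((S.erase a).erase i) := by
      intro j hj
      funext C'
      rw [hS (Cs.set j C') S h, ← haeq, getD_set_ne' Cs (Ne.symm (hT j hj).1), ← Finset.add_sum_erase _ _ hj,
        getD_set_self' Cs (hlen j (hT j hj).2),
        hafnian_set_of_not_mem h0 hS _ Cs (fun hm => (Finset.mem_erase.mp hm).1 rfl) C', mul_comm]
      congr 1
      refine Finset.sum_congr rfl fun i hi => ?_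
      rw [getD_set_ne' Cs (Finset.mem_erase.mp hi).1]
    -- ### the left side
    have L1 : D (Cs.getD a dflt) (fun C' => Hf (Cs.set a C') S) =
        ∑ i ∈ S.erase a, Hf Cs ((S.erase a).erase i) * D (Cs.getD a dflt) (fun C' => κ C' (Cs.getD i dflt)) := by
      rw [Ea, slot_sum D hadd hmul]
      refine Finset.sum_congr rfl fun i _ => ?_
      rw [hmul]
    have L2 : ∀ j ∈ S.erase a, D (Cs.getD j dflt) (fun C' => Hf (Cs.set j C') S) =
        Hf Cs ((S.erase a).erase j) * D (Cs.getD j dflt) (fun C' => κ (Cs.getD a dflt) C')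
          + ∑ i ∈ (S.erase a).erase j, κ (Cs.getD a dflt) (Cs.getD i dflt) *
              D (Cs.getD j dflt) (fun C' => Hf (Cs.set j C') ((S.erase a).erase i)) := by
      intro j hj
      rw [Ej j hj, hadd, hmul, slot_sum D hadd hmul]
      congr 1
      refine Finset.sum_congr rfl fun i _ => ?_
      rw [hmul]
    -- the cross terms, re-ordered and evaluated by induction
    have L3 : ∑ j ∈ S.erase a, ∑ i ∈ (S.erase a).erase j, κ (Cs.getD a dflt) (Cs.getD i dflt) *
          D (Cs.getD j dflt) (fun C' => Hf (Cs.set j C') ((S.erase a).erase i)) =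
        ∑ i ∈ S.erase a, κ (Cs.getD a dflt) (Cs.getD i dflt) *
          ∑ p ∈ (S.erase a).erase i, ∑ q ∈ (S.erase a).erase i, if p < q then
            (D (Cs.getD p dflt) (fun C' => κ C' (Cs.getD q dflt)) + D (Cs.getD q dflt) (fun C' => κ (Cs.getD p dflt) C'))
              * Hf Cs ((((S.erase a).erase i).erase p).erase q) else 0 := by
      rw [Finset.sum_comm' (t' := S.erase a) (s' := fun i => (S.erase a).erase i) (fun j i => by
        simp only [Finset.mem_erase]; tauto)]
      refine Finset.sum_congr rfl fun i hi => ?_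
      rw [← Finset.mul_sum, ih _ (hsubT i) Cs (fun k hk => hlen k ((hsubT i).subset hk))]
    -- ### the right side
    have R0 : ∀ p ∈ S.erase a, ∀ q ∈ S.erase a, Hf Cs ((S.erase p).erase q) =
        ∑ i ∈ ((S.erase a).erase p).erase q, κ (Cs.getD a dflt) (Cs.getD i dflt) * Hf Cs ((((S.erase a).erase p).erase q).erase i) := by
      intro p hp q hq
      have hapq : a ∈ (S.erase p).erase q :=
        Finset.mem_erase.mpr ⟨(hlt q hq).ne, Finset.mem_erase.mpr ⟨(hlt p hp).ne, ha⟩⟩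
      rw [hafnian_peel hS Cs _ hapq (fun y hy => Finset.min'_le S y
        (Finset.mem_of_mem_erase (Finset.mem_of_mem_erase hy)))]
      have hset : ((S.erase p).erase q).erase a = ((S.erase a).erase p).erase q := by
        rw [Finset.erase_right_comm, Finset.erase_right_comm (a := p)]
      rw [hset]
    have R1 : ∑ p ∈ S, ∑ q ∈ S, (if p < q then
          (D (Cs.getD p dflt) (fun C' => κ C' (Cs.getD q dflt)) + D (Cs.getD q dflt) (fun C' => κ (Cs.getD p dflt) C'))
            * Hf Cs ((S.erase p).erase q) else 0) =
        (∑ q ∈ S.erase a, (D (Cs.getD a dflt) (fun C' => κ C' (Cs.getD q dflt)) + D (Cs.getD q dflt) (fun C' => κ (Cs.getD a dflt) C'))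
            * Hf Cs ((S.erase a).erase q))
        + ∑ p ∈ S.erase a, ∑ q ∈ S.erase a, if p < q then
          (D (Cs.getD p dflt) (fun C' => κ C' (Cs.getD q dflt)) + D (Cs.getD q dflt) (fun C' => κ (Cs.getD p dflt) C'))
            * ∑ i ∈ ((S.erase a).erase p).erase q, κ (Cs.getD a dflt) (Cs.getD i dflt) *
                Hf Cs ((((S.erase a).erase p).erase q).erase i) else 0 := by
      rw [← Finset.add_sum_erase S _ ha]
      congr 1
      · rw [← Finset.add_sum_erase S _ ha, if_neg (lt_irrefl a), zero_add]
        refine Finset.sum_congr rfl fun q hq => ?_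
        rw [if_pos (hlt q hq)]
      · refine Finset.sum_congr rfl fun p hp => ?_
        rw [← Finset.add_sum_erase S _ ha, if_neg (not_lt.mpr (hlt p hp).le), zero_add]
        refine Finset.sum_congr rfl fun q hq => ?_
        split_ifs with hpq
        · rw [R0 p hp q hq]
        · rfl
    -- ### the triple-sum identity
    have TRI : ∑ i ∈ S.erase a, κ (Cs.getD a dflt) (Cs.getD i dflt) *
          ∑ p ∈ (S.erase a).erase i, ∑ q ∈ (S.erase a).erase i, (if p < q then
            (D (Cs.getD p dflt) (fun C' => κ C' (Cs.getD q dflt)) + D (Cs.getD q dflt) (fun C' => κ (Cs.getD p dflt) C'))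
              * Hf Cs ((((S.erase a).erase i).erase p).erase q) else 0) =
        ∑ p ∈ S.erase a, ∑ q ∈ S.erase a, if p < q then
          (D (Cs.getD p dflt) (fun C' => κ C' (Cs.getD q dflt)) + D (Cs.getD q dflt) (fun C' => κ (Cs.getD p dflt) C'))
            * ∑ i ∈ ((S.erase a).erase p).erase q, κ (Cs.getD a dflt) (Cs.getD i dflt) *
                Hf Cs ((((S.erase a).erase p).erase q).erase i) else 0 := by
      -- both sides as indicator sums over `T × T × T`
      have lhs : ∀ i ∈ S.erase a, κ (Cs.getD a dflt) (Cs.getD i dflt) *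
          ∑ p ∈ (S.erase a).erase i, ∑ q ∈ (S.erase a).erase i, (if p < q then
            (D (Cs.getD p dflt) (fun C' => κ C' (Cs.getD q dflt)) + D (Cs.getD q dflt) (fun C' => κ (Cs.getD p dflt) C'))
              * Hf Cs ((((S.erase a).erase i).erase p).erase q) else 0) =
          ∑ p ∈ S.erase a, ∑ q ∈ S.erase a, if p = i then 0 else if q = i then 0 else if p < q then
            κ (Cs.getD a dflt) (Cs.getD i dflt) *
              ((D (Cs.getD p dflt) (fun C' => κ C' (Cs.getD q dflt)) + D (Cs.getD q dflt) (fun C' => κ (Cs.getD p dflt) C'))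
                * Hf Cs ((((S.erase a).erase p).erase q).erase i)) else 0 := by
        intro i _
        rw [Finset.mul_sum, sum_erase_ite]
        refine Finset.sum_congr rfl fun p _ => ?_
        by_cases hpi : p = i
        · rw [if_pos hpi]
          exact (Finset.sum_eq_zero fun q _ => by rw [if_pos hpi]).symm
        rw [if_neg hpi, Finset.mul_sum, sum_erase_ite]
        refine Finset.sum_congr rfl fun q _ => ?_
        by_cases hqi : q = i
        · rw [if_pos hqi, if_neg hpi, if_pos hqi]
        rw [if_neg hqi, if_neg hpi, if_neg hqi]
        by_cases hpq : p < q
        · rw [if_pos hpq, if_pos hpq, Finset.erase_right_comm (a := i) (b := p), Finset.erase_right_comm (a := i) (b := q)]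
        · rw [if_neg hpq, if_neg hpq, mul_zero]
      have rhs : ∀ p ∈ S.erase a, ∀ q ∈ S.erase a, (if p < q then
          (D (Cs.getD p dflt) (fun C' => κ C' (Cs.getD q dflt)) + D (Cs.getD q dflt) (fun C' => κ (Cs.getD p dflt) C'))
            * ∑ i ∈ ((S.erase a).erase p).erase q, κ (Cs.getD a dflt) (Cs.getD i dflt) *
                Hf Cs ((((S.erase a).erase p).erase q).erase i) else 0) =
          ∑ i ∈ S.erase a, if p = i then 0 else if q = i then 0 else if p < q then
            κ (Cs.getD a dflt) (Cs.getD i dflt) *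
              ((D (Cs.getD p dflt) (fun C' => κ C' (Cs.getD q dflt)) + D (Cs.getD q dflt) (fun C' => κ (Cs.getD p dflt) C'))
                * Hf Cs ((((S.erase a).erase p).erase q).erase i)) else 0 := by
        intro p _ q _
        by_cases hpq : p < q
        · rw [if_pos hpq, Finset.mul_sum, sum_erase_ite, sum_erase_ite]
          refine Finset.sum_congr rfl fun i _ => ?_
          by_cases hip : i = p
          · rw [if_pos hip, if_pos hip.symm]
          by_cases hiq : i = q
          · rw [if_neg hip, if_pos hiq, if_neg (Ne.symm hip), if_pos hiq.symm]
          rw [if_neg hip, if_neg hiq, if_neg (Ne.symm hip), if_neg (Ne.symm hiq), if_pos hpq]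
          ring
        · rw [if_neg hpq]
          symm
          refine Finset.sum_eq_zero fun i _ => ?_
          by_cases hip : p = i
          · rw [if_pos hip]
          by_cases hiq : q = i
          · rw [if_neg hip, if_pos hiq]
          rw [if_neg hip, if_neg hiq, if_neg hpq]
      rw [Finset.sum_congr rfl lhs, Finset.sum_congr rfl fun p hp => Finset.sum_congr rfl fun q hq => rhs p hp q hq,
        Finset.sum_comm]
      refine Finset.sum_congr rfl fun p _ => ?_
      rw [Finset.sum_comm]
    -- ### assemble
    rw [← Finset.add_sum_erase S _ ha, L1, Finset.sum_congr rfl L2, Finset.sum_add_distrib, L3, TRI, R1, ← add_assoc,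
      ← Finset.sum_add_distrib]
    congr 1
    refine Finset.sum_congr rfl fun q _ => ?_
    ring

end leibniz

end StringDuality

end Summit.QuantumFields.GaugeBoot

end
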